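import Mathlib.Topology.ContinuousMap.Bounded.ArzelaAscoli
import Mathlib.Topology.MetricSpace.Equicontinuity
import Mathlib.Topology.MetricSpace.ProperSpace
import Mathlib.Analysis.Normed.Group.Basic
import Mathlib.Analysis.SpecialFunctions.Pow.Continuity
import Mathlib.Analysis.InnerProductSpace.PiL2
import Mathlib.Topology.UniformSpace.LocallyUniformConvergence
import HarnessLib

/-!
# Diagonal Arzelà–Ascoli extraction for locally bounded, locally Hölder families, and the
# exhaustion of the open slab `(−∞, 0) × E`

Analysis/FluidPDE support file (everything proved, no definitions beyond Mathlib's) for the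
discharge of `Literature.Analysis.FluidPDE.KNSS2009_typeI_rate_compactness`
(Koch–Nadirashvili–Seregin–Šverák 2009, Lemma 6.1 as used in the proof of Theorem 6.2: "we can
choose a subsequence of the sequence `w⁽ᵏ⁾` … such that the `w⁽ᵏ⁾` converge uniformly on
compact subsets of `ℝ³ × (−∞, 0)`", arXiv:0709.3599 p. 13). The compactness is Arzelà–Ascoli
along one diagonal subsequence; this file isolates the general-topology part:

* `exists_strictMono_tendstoUniformlyOn_of_bound` — given compact sets `T n` of a metric space
  and maps `V k` into a proper normed group which, for each `n` and all large `k`, are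
  continuous on `T n`, bounded there by `R n` and share a Hölder modulus
  `dist (V k z) (V k z') ≤ K n * dist z z' ^ α n`, some subsequence converges uniformly on every
  `T n` to one map `W`. This is the sibling lemma
  `SereginSverak2009.exists_strictMono_tendstoUniformlyOn` (`SereginSverakBlowupExtraction.lean`)
  with the bound `1` replaced by `R n`; the proof is the same (Mathlib's
  `BoundedContinuousFunction.arzela_ascoli₂` on each `T n` and sequential compactness of the
  product of the resulting compact sets of `T n →ᵇ Y`).
* the compact "slab pieces" `[−(n+2), −1/(n+2)] × B̄(0, n+2)` exhausting the open slab
  `(−∞, 0) × E` of a proper space (written out; no definition is introduced), every point of the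
  slab being interior to some piece (`eventually_slabPiece_mem_nhds`), whence: a map converging uniformly on every piece along eventually
  continuous maps has a limit continuous on the open slab (`continuousOn_slab_of_tendstoUniformlyOn`),
  converging pointwise (`tendsto_of_tendstoUniformlyOn_slabPiece`) and slice-wise locally uniformly
  (`tendstoLocallyUniformly_slice_of_tendstoUniformlyOn_slabPiece`).

## References

* G. Koch, N. Nadirashvili, G. Seregin, V. Šverák, Acta Math. 203 (2009) = arXiv:0709.3599,
  Lemma 6.1 (p. 11) and proof of Thm. 6.2 (p. 13). [KochNadirashviliSereginSverak2009]
-/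

noncomputable section

open Set Function Filter Topology Metric
open scoped BoundedContinuousFunction NNReal

namespace Literature.Analysis.FluidPDE

/-! ### The diagonal Arzelà–Ascoli extraction with variable bounds -/

section Extraction

/-- **Diagonal Arzelà–Ascoli, locally bounded form.** Let `T n` be compact subsets of a metric
space and `V k` maps into a proper normed group which, for each `n` and all large `k`, are
continuous on `T n`, bounded by `R n` there, and share the modulus
`dist (V k z) (V k z') ≤ K n * dist z z' ^ α n` (`0 ≤ K n`, `0 < α n`). Then along some
subsequence `φ` the maps `V (φ j)` converge uniformly on every `T n` to a single map `W`.
[folklore] -/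
theorem exists_strictMono_tendstoUniformlyOn_of_bound {X Y : Type*} [PseudoMetricSpace X]
    [NormedAddCommGroup Y] [ProperSpace Y] {T : ℕ → Set X} (hT : ∀ n, IsCompact (T n))
    {V : ℕ → X → Y} {R K α : ℕ → ℝ} (hK : ∀ n, 0 ≤ K n) (hα : ∀ n, 0 < α n)
    (hV : ∀ n, ∀ᶠ k in atTop, ContinuousOn (V k) (T n) ∧ (∀ z ∈ T n, ‖V k z‖ ≤ R n) ∧
      ∀ z ∈ T n, ∀ z' ∈ T n, dist (V k z) (V k z') ≤ K n * dist z z' ^ α n) :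
    ∃ φ : ℕ → ℕ, StrictMono φ ∧ ∃ W : X → Y,
      ∀ n, TendstoUniformlyOn (fun j => V (φ j)) W atTop (T n) := by
  classical
  haveI : ∀ n, CompactSpace (T n) := fun n => isCompact_iff_compactSpace.1 (hT n)
  -- the compact sets of bounded continuous functions on the `T n` cut out by the bounds
  let S : ∀ n, Set (T n →ᵇ Y) := fun n =>
    {f | (∀ x, ‖f x‖ ≤ R n) ∧ ∀ x y, dist (f x) (f y) ≤ K n * dist x y ^ α n}
  have hS : ∀ n, IsCompact (S n) := by
    intro n
    refine BoundedContinuousFunction.arzela_ascoli₂ (closedBall (0 : Y) (R n))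
      (isCompact_closedBall 0 (R n)) (S n) ?_ (fun f x hf => mem_closedBall_zero_iff.2 (hf.1 x)) ?_
    · have h1 : IsClosed {f : T n →ᵇ Y | ∀ x, ‖f x‖ ≤ R n} := by
        have heq : {f : T n →ᵇ Y | ∀ x, ‖f x‖ ≤ R n} = ⋂ x, {f | ‖f x‖ ≤ R n} := by
          ext f
          simp
        rw [heq]
        exact isClosed_iInter fun x =>
          isClosed_le (continuous_eval_const x).norm continuous_const
      have h2 : IsClosed {f : T n →ᵇ Y | ∀ x y, dist (f x) (f y) ≤ K n * dist x y ^ α n} := by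
        have heq : {f : T n →ᵇ Y | ∀ x y, dist (f x) (f y) ≤ K n * dist x y ^ α n} =
            ⋂ x, ⋂ y, {f | dist (f x) (f y) ≤ K n * dist x y ^ α n} := by
          ext f
          simp
        rw [heq]
        exact isClosed_iInter fun x => isClosed_iInter fun y =>
          isClosed_le ((continuous_eval_const x).dist
            (continuous_eval_const y)) continuous_const
      exact h1.inter h2
    · refine Metric.equicontinuous_of_continuity_modulus (fun d => K n * d ^ α n) ?_ _ ?_
      · have hc : Continuous fun d : ℝ => K n * d ^ α n :=
          continuous_const.mul (continuous_id.rpow_const fun d => Or.inr (hα n).le)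
        simpa [Real.zero_rpow (hα n).ne'] using hc.tendsto 0
      · rintro x y ⟨f, hf⟩
        exact hf.2 x y
  have hSpi : IsCompact (Set.pi univ S) := isCompact_univ_pi hS
  -- the bounds, and the restrictions of the `V k` to the `T n` as bounded continuous functions
  let P : ℕ → ℕ → Prop := fun n k => ContinuousOn (V k) (T n) ∧ (∀ z ∈ T n, ‖V k z‖ ≤ R n) ∧
    ∀ z ∈ T n, ∀ z' ∈ T n, dist (V k z) (V k z') ≤ K n * dist z z' ^ α n
  let F : ℕ → ∀ n, (T n →ᵇ Y) := fun k n =>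
    if h : P n k then BoundedContinuousFunction.mkOfCompact
      ⟨(T n).restrict (V k), continuousOn_iff_continuous_restrict.1 h.1⟩ else
      BoundedContinuousFunction.const (T n) (if hz : (T n).Nonempty then V (Nat.find (hV n).exists)
        hz.some else 0)
  have hFP : ∀ k n, P n k → ∀ x : T n, F k n x = V k x := fun k n h x => by
    simp only [F, dif_pos h]
    rfl
  have hF : ∀ k, F k ∈ Set.pi univ S := by
    intro k n _
    by_cases h : P n k
    · refine ⟨fun x => ?_, fun x y => ?_⟩
      · rw [hFP k n h x]
        exact h.2.1 x x.2
      · rw [hFP k n h x, hFP k n h y]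
        exact h.2.2 x x.2 y y.2
    · -- the fallback constant: a value of an admissible `V k₀` (so that the bound `R n` holds)
      have hk₀ : P n (Nat.find (hV n).exists) := Nat.find_spec (hV n).exists
      simp only [F, dif_neg h]
      refine ⟨fun x => ?_, fun x y => ?_⟩
      · have hz : (T n).Nonempty := ⟨x, x.2⟩
        simp only [BoundedContinuousFunction.const_apply, dif_pos hz]
        exact hk₀.2.1 _ hz.some_mem
      · simp only [BoundedContinuousFunction.const_apply, dist_self]
        exact mul_nonneg (hK n) (Real.rpow_nonneg dist_nonneg _)
  -- one subsequence for all `n` at once: sequential compactness of the product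
  obtain ⟨G, -, φ, hφ, hlim⟩ := hSpi.tendsto_subseq hF
  refine ⟨φ, hφ, ?_⟩
  have hn : ∀ n, TendstoUniformly (fun j => ⇑(F (φ j) n)) (⇑(G n)) atTop := fun n =>
    BoundedContinuousFunction.tendsto_iff_tendstoUniformly.1
      (((continuous_apply n).tendsto G).comp hlim)
  have hev : ∀ n, ∀ᶠ j in atTop, ∀ x : T n, F (φ j) n x = V (φ j) x := fun n => by
    filter_upwards [hφ.tendsto_atTop.eventually (hV n)] with j hj
    exact hFP (φ j) n hj
  have hpt : ∀ m (z : X) (hz : z ∈ T m),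
      Tendsto (fun j => V (φ j) z) atTop (𝓝 (G m ⟨z, hz⟩)) := fun m z hz => by
    refine ((hn m).tendsto_at ⟨z, hz⟩).congr' ?_
    filter_upwards [hev m] with j hj
    exact hj ⟨z, hz⟩
  -- the common limit
  let W : X → Y := fun z => if h : ∃ n, z ∈ T n then G (Nat.find h) ⟨z, Nat.find_spec h⟩ else 0
  refine ⟨W, fun n => ?_⟩
  have hW : ∀ z (hz : z ∈ T n), W z = G n ⟨z, hz⟩ := fun z hz => by
    have hex : ∃ m, z ∈ T m := ⟨n, hz⟩
    simp only [W, dif_pos hex]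
    exact tendsto_nhds_unique (hpt _ z _) (hpt n z hz)
  rw [tendstoUniformlyOn_iff_tendstoUniformly_comp_coe]
  have hWG : (W ∘ ((↑) : T n → X)) = ⇑(G n) := funext fun x => by
    simpa using hW x x.2
  rw [hWG, tendstoUniformly_congr (F' := fun j => ⇑(F (φ j) n))]
  · exact hn n
  · filter_upwards [hev n] with j hj
    exact funext fun x => (hj x).symm

end Extraction

/-! ### The exhaustion of the open slab `(−∞, 0) × E` by compact pieces -/

section Slab

variable {E : Type*} [NormedAddCommGroup E]

/-- Membership in the slab piece `[−(n+2), −1/(n+2)] × B̄(0, n+2)`, unfolded. [folklore] -/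
theorem mem_slabPiece {n : ℕ} {z : ℝ × E} :
    z ∈ Icc (-((n : ℝ) + 2)) (-(1 / ((n : ℝ) + 2))) ×ˢ closedBall (0 : E) ((n : ℝ) + 2) ↔
      (-((n : ℝ) + 2) ≤ z.1 ∧ z.1 ≤ -(1 / ((n : ℝ) + 2))) ∧ ‖z.2‖ ≤ (n : ℝ) + 2 := by
  simp [mem_prod, mem_Icc, mem_closedBall, dist_zero_right]

/-- The slab pieces `[−(n+2), −1/(n+2)] × B̄(0, n+2)` are compact when `E` is proper. [folklore] -/
theorem isCompact_slabPiece [ProperSpace E] (n : ℕ) :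
    IsCompact (Icc (-((n : ℝ) + 2)) (-(1 / ((n : ℝ) + 2))) ×ˢ closedBall (0 : E) ((n : ℝ) + 2)) :=
  isCompact_Icc.prod (isCompact_closedBall _ _)

/-- The slab pieces lie in the open slab `(−∞, 0) × E`: their times are negative. [folklore] -/
theorem neg_of_mem_slabPiece {n : ℕ} {z : ℝ × E}
    (hz : z ∈ Icc (-((n : ℝ) + 2)) (-(1 / ((n : ℝ) + 2))) ×ˢ closedBall (0 : E) ((n : ℝ) + 2)) :
    z.1 < 0 := by
  have h := (mem_slabPiece.1 hz).1.2
  have : (0 : ℝ) < 1 / ((n : ℝ) + 2) := by positivity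
  linarith

/-- **Every point of the open slab is interior to some slab piece**: if `t < 0` then
`[−(n+2), −1/(n+2)] × B̄(0, n+2)` is a neighbourhood of `(t, x)` for all large `n`. [folklore] -/
theorem eventually_slabPiece_mem_nhds {t : ℝ} (ht : t < 0) (x : E) :
    ∀ᶠ n : ℕ in atTop,
      Icc (-((n : ℝ) + 2)) (-(1 / ((n : ℝ) + 2))) ×ˢ closedBall (0 : E) ((n : ℝ) + 2) ∈ 𝓝 (t, x) := by
  have h1 : ∀ᶠ n : ℕ in atTop, -t + 1 ≤ (n : ℝ) := tendsto_natCast_atTop_atTop.eventually_ge_atTop _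
  have h2 : ∀ᶠ n : ℕ in atTop, 2 / (-t) ≤ (n : ℝ) := tendsto_natCast_atTop_atTop.eventually_ge_atTop _
  have h3 : ∀ᶠ n : ℕ in atTop, ‖x‖ + 1 ≤ (n : ℝ) := tendsto_natCast_atTop_atTop.eventually_ge_atTop _
  filter_upwards [h1, h2, h3] with n hn1 hn2 hn3
  have ht0 : 0 < -t := neg_pos.2 ht
  have hn0 : (0 : ℝ) < (n : ℝ) + 2 := by positivity
  -- `1/(n+2) ≤ -t/2`
  have hsmall : 1 / ((n : ℝ) + 2) ≤ -t / 2 := by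
    rw [div_le_iff₀ hn0]
    have : 2 / -t * -t = 2 := div_mul_cancel₀ _ ht0.ne'
    nlinarith
  -- the open box around `(t, x)` inside the piece
  have hbox : Ioo (t - 1) (t / 2) ×ˢ ball x 1 ⊆
      Icc (-((n : ℝ) + 2)) (-(1 / ((n : ℝ) + 2))) ×ˢ closedBall (0 : E) ((n : ℝ) + 2) := by
    intro z hz
    obtain ⟨⟨hz1, hz2⟩, hz3⟩ := hz
    rw [mem_ball] at hz3
    refine mem_slabPiece.2 ⟨⟨by linarith, by linarith⟩, ?_⟩
    calc ‖z.2‖ ≤ ‖x‖ + dist z.2 x := by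
          have := norm_le_norm_add_norm_sub' z.2 x
          rwa [← dist_eq_norm] at this
      _ ≤ (n : ℝ) + 2 := by linarith
  refine Filter.mem_of_superset ?_ hbox
  exact prod_mem_nhds (Ioo_mem_nhds (by linarith) (by linarith)) (ball_mem_nhds x one_pos)

/-- Every point of the open slab lies in some slab piece. [folklore] -/
theorem exists_mem_slabPiece {t : ℝ} (ht : t < 0) (x : E) :
    ∃ n : ℕ, (t, x) ∈ Icc (-((n : ℝ) + 2)) (-(1 / ((n : ℝ) + 2))) ×ˢ closedBall (0 : E) ((n : ℝ) + 2) := by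
  obtain ⟨n, hn⟩ := (eventually_slabPiece_mem_nhds ht x).exists
  exact ⟨n, mem_of_mem_nhds hn⟩

/-- A compact set of the form `{t} × K`, `t < 0`, `K` compact, lies in some slab piece. [folklore] -/
theorem exists_singleton_prod_subset_slabPiece {t : ℝ} (ht : t < 0) {K : Set E} (hK : IsCompact K) :
    ∃ n : ℕ, ({t} : Set ℝ) ×ˢ K ⊆
      Icc (-((n : ℝ) + 2)) (-(1 / ((n : ℝ) + 2))) ×ˢ closedBall (0 : E) ((n : ℝ) + 2) := by
  obtain ⟨ρ, hρ⟩ := hK.isBounded.subset_closedBall 0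
  have h1 : ∀ᶠ n : ℕ in atTop, -t ≤ (n : ℝ) := tendsto_natCast_atTop_atTop.eventually_ge_atTop _
  have h2 : ∀ᶠ n : ℕ in atTop, 1 / (-t) ≤ (n : ℝ) := tendsto_natCast_atTop_atTop.eventually_ge_atTop _
  have h3 : ∀ᶠ n : ℕ in atTop, ρ ≤ (n : ℝ) := tendsto_natCast_atTop_atTop.eventually_ge_atTop _
  obtain ⟨n, hn1, hn2, hn3⟩ := (h1.and (h2.and h3)).exists
  have ht0 : 0 < -t := neg_pos.2 ht
  have hn0 : (0 : ℝ) < (n : ℝ) + 2 := by positivity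
  have hsmall : 1 / ((n : ℝ) + 2) ≤ -t := by
    rw [div_le_iff₀ hn0]
    have : 1 / -t * -t = 1 := div_mul_cancel₀ _ ht0.ne'
    nlinarith
  refine ⟨n, fun z hz => ?_⟩
  obtain ⟨hz1, hz2⟩ := hz
  rw [mem_singleton_iff] at hz1
  have hz3 : ‖z.2‖ ≤ ρ := by simpa [mem_closedBall, dist_zero_right] using hρ hz2
  exact mem_slabPiece.2 ⟨⟨by rw [hz1]; linarith, by rw [hz1]; linarith⟩, hz3.trans (by linarith)⟩

variable {Y : Type*} [UniformSpace Y]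

/-- **Continuity of the limit on the open slab.** If `V j → W` uniformly on every slab piece
`[−(n+2), −1/(n+2)] × B̄(0, n+2)` and each `V j` is eventually continuous on every piece, then `W`
is continuous on the open slab `(−∞, 0) × E` (uniform limits of continuous maps are continuous,
and every point of the slab is interior to a piece). [folklore] -/
theorem continuousOn_slab_of_tendstoUniformlyOn {ι : Type*} {p : Filter ι} [p.NeBot]
    {V : ι → ℝ × E → Y} {W : ℝ × E → Y}
    (hV : ∀ n : ℕ, ∀ᶠ j in p, ContinuousOn (V j)
      (Icc (-((n : ℝ) + 2)) (-(1 / ((n : ℝ) + 2))) ×ˢ closedBall (0 : E) ((n : ℝ) + 2)))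
    (hW : ∀ n : ℕ, TendstoUniformlyOn V W p
      (Icc (-((n : ℝ) + 2)) (-(1 / ((n : ℝ) + 2))) ×ˢ closedBall (0 : E) ((n : ℝ) + 2))) :
    ContinuousOn W (Iio 0 ×ˢ univ) := by
  rintro ⟨t, x⟩ ⟨ht, -⟩
  obtain ⟨n, hn⟩ := (eventually_slabPiece_mem_nhds (E := E) ht x).exists
  have hc : ContinuousOn W _ := (hW n).continuousOn (hV n).frequently
  exact (hc.continuousAt hn).continuousWithinAt

/-- **Pointwise convergence on the open slab** from uniform convergence on the pieces. [folklore] -/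
theorem tendsto_of_tendstoUniformlyOn_slabPiece {ι : Type*} {p : Filter ι}
    {V : ι → ℝ × E → Y} {W : ℝ × E → Y}
    (hW : ∀ n : ℕ, TendstoUniformlyOn V W p
      (Icc (-((n : ℝ) + 2)) (-(1 / ((n : ℝ) + 2))) ×ˢ closedBall (0 : E) ((n : ℝ) + 2)))
    {t : ℝ} (ht : t < 0) (x : E) :
    Tendsto (fun j => V j (t, x)) p (𝓝 (W (t, x))) := by
  obtain ⟨n, hn⟩ := exists_mem_slabPiece (E := E) ht x
  exact (hW n).tendsto_at hn

/-- **Slice-wise locally uniform convergence** from uniform convergence on the pieces: for every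
`t < 0` the slices `x ↦ V j (t, x)` converge to `x ↦ W (t, x)` locally uniformly on `E`
(`E` proper, so locally uniform convergence is uniform convergence on compact sets, and
`{t} × K` lies in a piece). [folklore] -/
theorem tendstoLocallyUniformly_slice_of_tendstoUniformlyOn_slabPiece [ProperSpace E] {ι : Type*}
    {p : Filter ι} {V : ι → ℝ × E → Y} {W : ℝ × E → Y}
    (hW : ∀ n : ℕ, TendstoUniformlyOn V W p
      (Icc (-((n : ℝ) + 2)) (-(1 / ((n : ℝ) + 2))) ×ˢ closedBall (0 : E) ((n : ℝ) + 2)))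
    {t : ℝ} (ht : t < 0) :
    TendstoLocallyUniformly (fun j x => V j (t, x)) (fun x => W (t, x)) p := by
  rw [tendstoLocallyUniformly_iff_forall_isCompact]
  intro K hK
  obtain ⟨n, hn⟩ := exists_singleton_prod_subset_slabPiece (E := E) ht hK
  have h := (hW n).mono hn
  -- transport along the embedding `x ↦ (t, x)`
  rw [tendstoUniformlyOn_iff_tendsto] at h ⊢
  have hmap : Tendsto (fun q : ι × E => (q.1, (t, q.2))) (p ×ˢ 𝓟 K) (p ×ˢ 𝓟 (({t} : Set ℝ) ×ˢ K)) := by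
    refine Tendsto.prodMk tendsto_fst ?_
    have : Tendsto (fun q : ι × E => (t, q.2)) (p ×ˢ 𝓟 K) (𝓟 (({t} : Set ℝ) ×ˢ K)) := by
      rw [tendsto_principal]
      filter_upwards [tendsto_snd (f := p) (g := 𝓟 K) (mem_principal_self K)] with q hq
      exact ⟨mem_singleton t, hq⟩
    exact this
  exact h.comp hmap

end Slab

end Literature.Analysis.FluidPDE

end
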